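/-
Copyright (c) 2026 the pub-hodgecm-mathlib formalisation cell (harness21).  Prover seat hodgecm-mathlib-LH4-p09 (g8), req620 Track A «(D-RAM) FOUR-FRAME» squad
(heir dealer LH4-plan (g13) WORD #73 (1): (o2) «the D₂ read letter at n₁ = n₂ as an honest trichotomy lemma»).  2026-09-04.
-/
import Summits.HodgeConjecture.HodgeConjecture.Theorems.F0P3cDyRamLabelledKappaTwoTokenCoreHanging     -- ★ p859999 (this seat) T2a: the H two-token heads whose `[reads₂]` this file makes numeric; brings K6 ★ p859864
import HarnessLib

/-!
# (D-RAM) four-frame, STAGE 1b — the `D₂` READ LETTER `|(β−1)² − (α−1)²|`: factorisation, bounds, the trichotomy at `n₁ = n₂`, and the consequence that the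
# outer `D₂` read on an equal-depth datum is just `ℓ₂ + ρ ≤ 2n₂` (so ★ p859999 ∕ ★ p859864's H heads lose their last symbolic conjunct)

Helper brick for dealer LH4-plan (g13) WORD #73 (1) ((o2) taken): `Theorems/` only, statement-first, ★-only imports, lane `--supports stmt-HodgeConjecture-24833 --as helper`;
it PAYS NO tier-0 row (count-neutral).

THE LETTER.  `(β−1)² − (α−1)² = (β−α)·(α+β−2)` and `α+β−2 = (α−1)+(β−1)`, so `|(β−1)² − (α−1)²| = |ϖ|^{n₃}·|α+β−2|` with `|α+β−2| ≤ |ϖ|^{min(n₁,n₂)}`, EQUALITY off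
the equal-depth locus (`n₁ ≠ n₂`, ultrametric), possibly DEEPER on it (`n₁ = n₂`: the sum `(α−1)+(β−1)` may cancel) — the honest trichotomy.  CONSEQUENCE: the outer
`D₂` read of the H heads, `([|D₂ᵢ| ≤ |ϖ|^{ℓ₂}] ∧ |(β−1)²−(α−1)²| ≤ |ϖ|^{ℓ₂+ρ}) ∧ ℓ₂ + ρ ≤ 2n₂`, is EQUIVALENT to its last conjunct `ℓ₂ + ρ ≤ 2n₂` whenever `n₁ = n₂ ≤ n₃`
(then `ℓ₂ + ρ ≤ 2n₂ ≤ n₂ + n₃ ≤ v((β−1)²−(α−1)²)`): the cancellation can only HELP, never hurt, so the tokens decide the conjunct by themselves.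

* §1 `sq_sub_sq_eq`, `v_sq_sub_sq_eq`, `v_add_sub_two_le`, `v_add_sub_two_eq_of_ne`, `v_sq_sub_sq_le`, `v_sq_sub_sq_eq_of_ne` (the trichotomy).
* §2 **`sqToken_outerRead_H_iff`** — on `n₁ = n₂ ≤ n₃`: `reads₂ ↔ ℓ₂ + ρ ≤ 2n₂`.
* §3 NUMERIC COROLLARIES of ★ p859999 and ★ p859864: **`finsum_kappaCount_mul_stabiliserWeight_stratum_H_sep_levels_foot_numeric ∕ _tube_numeric`** (two tokens) and
  **`…_H_sep_sqToken_foot_numeric ∕ _tube_numeric`** (one token) — the same heads with `[reads₂]` replaced by `[ℓ₂ + ρ ≤ 2n₂]`.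

HONEST LABEL: helper organs for HYPOTHESES (the labelled trunks); STAGE-1b tier-0 rows and the ED. 5∕6 law stubs stay OPEN; HC_CM is proved only modulo the 7 printed
citations (2 remaining named inputs: hLiu418 = `stmt-HodgeConjecture-24832`, h413 = `stmt-HodgeConjecture-24833`) until rung 0 closes.

## References
* [Kottwitz1986BaseChangeUnits] R. E. Kottwitz, *Base change for unit elements of Hecke algebras*, Compositio Math. 60 (1986), §1 pp. 240–241 (lattice counts modulo the torus).
* [Rogawski1990] J. D. Rogawski, *Automorphic Representations of Unitary Groups in Three Variables*, Ann. of Math. Stud. 123 (1990), §4.9 Prop. 4.9.1 (a)(b) p. 55 (root depths of a regular element).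
* [Serre1980Trees] J.-P. Serre, *Trees*, Springer (1980), Ch. II §1.1 (the ultrametric inequality and its equality case).
-/

set_option autoImplicit false

noncomputable section

namespace Summit.HodgeConjecture.HodgeConjecture.Cruxes.H413.F0P3cDyRamSqTokenReadLetter

open Matrix WithZero
open Literature.NumberTheory.Automorphic Literature.NumberTheory.Automorphic.HermitianLattice Literature.NumberTheory.Automorphic.UnitaryGroup
open Literature.NumberTheory.Automorphic.UnitaryLatticeTree Literature.NumberTheory.Automorphic.UnitaryThreeFourFrame
open Literature.NumberTheory.LocalFields.WildQuadraticDatum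
open Summit.HodgeConjecture.HodgeConjecture.Cruxes.H413.F0P3cDyRamDiagonalTorusDefs
open Summit.HodgeConjecture.HodgeConjecture.Cruxes.H413.F0P3cDyRamDiagonalStrataDefs
open Summit.HodgeConjecture.HodgeConjecture.Cruxes.H413.F0P3cDyRamDiagonalKappaCountDefs
open Summit.HodgeConjecture.HodgeConjecture.Cruxes.H413.F0P3cDyRamDiagonalGluedStabiliserIndex (ne_zero_and_v_lt_one_of_v_eq_exp)
open Summit.HodgeConjecture.HodgeConjecture.Cruxes.H413.F0P3cDyRamElementDatumParity (isoceles_of_isElementDatum)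
open Summit.HodgeConjecture.HodgeConjecture.Cruxes.H413.F0P3cDyRamFourFrameCensusDefs
open Summit.HodgeConjecture.HodgeConjecture.Cruxes.H413.F0P3cDyRamLabelledKappaSqTokenCells
open Summit.HodgeConjecture.HodgeConjecture.Cruxes.H413.F0P3cDyRamLabelledKappaTwoTokenCoreHanging
open scoped Valued WithZero Matrix MatrixGroups

/-! ## §1  The letter `|(β−1)² − (α−1)²|` -/

section Letter

variable {K : Type*} [Field K] [Valued K ℤᵐ⁰]

omit [Valued K ℤᵐ⁰] in
/-- `(β−1)² − (α−1)² = (β−α)·(α+β−2)`. [cite: Rogawski1990, §4.9 Prop. 4.9.1 (a) p. 55] -/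
theorem sq_sub_sq_eq (α β : K) : (β - 1) * (β - 1) - (α - 1) * (α - 1) = (β - α) * (α + β - 2) := by ring

/-- `|(β−1)² − (α−1)²| = |α−β|·|α+β−2|`. [cite: Rogawski1990, §4.9 Prop. 4.9.1 (a) p. 55] -/
theorem v_sq_sub_sq_eq (α β : K) : Valued.v ((β - 1) * (β - 1) - (α - 1) * (α - 1)) = Valued.v (α - β) * Valued.v (α + β - 2) := by
  rw [sq_sub_sq_eq, map_mul, Valuation.map_sub_swap]

/-- `|α+β−2| ≤ |ϖ|^{min(n₁,n₂)}` (`α+β−2 = (α−1)+(β−1)`, ultrametric). [cite: Serre1980Trees, II §1.1] -/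
theorem v_add_sub_two_le {ϖ α β : K} (hϖ1 : Valued.v ϖ ≤ 1) {n₁ n₂ : ℕ} (h₁ : Valued.v (β - 1) = Valued.v ϖ ^ n₁) (h₂ : Valued.v (α - 1) = Valued.v ϖ ^ n₂) :
    Valued.v (α + β - 2) ≤ Valued.v ϖ ^ min n₁ n₂ := by
  rw [show α + β - 2 = (α - 1) + (β - 1) by ring]
  refine Valuation.map_add_le _ ?_ ?_
  · rw [h₂]; exact pow_le_pow_right_of_le_one' hϖ1 (min_le_right _ _)
  · rw [h₁]; exact pow_le_pow_right_of_le_one' hϖ1 (min_le_left _ _)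

/-- **OFF THE EQUAL-DEPTH LOCUS THERE IS NO CANCELLATION**: `n₁ ≠ n₂ ⇒ |α+β−2| = |ϖ|^{min(n₁,n₂)}`. [cite: Serre1980Trees, II §1.1] -/
theorem v_add_sub_two_eq_of_ne {ϖ α β : K} (hϖ : Valued.v ϖ = exp (-1 : ℤ)) {n₁ n₂ : ℕ} (h₁ : Valued.v (β - 1) = Valued.v ϖ ^ n₁)
    (h₂ : Valued.v (α - 1) = Valued.v ϖ ^ n₂) (hne : n₁ ≠ n₂) : Valued.v (α + β - 2) = Valued.v ϖ ^ min n₁ n₂ := by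
  obtain ⟨hϖ0, hϖ1⟩ := ne_zero_and_v_lt_one_of_v_eq_exp hϖ
  have hvϖ : 0 < Valued.v ϖ := (Valuation.pos_iff _).2 hϖ0
  rcases lt_or_gt_of_ne hne with h | h
  · rw [min_eq_left h.le, show α + β - 2 = (β - 1) + (α - 1) by ring,
      Valuation.map_add_eq_of_lt_left _ (by rw [h₁, h₂]; exact pow_lt_pow_right_of_lt_one₀ hvϖ hϖ1 h), h₁]
  · rw [min_eq_right h.le, show α + β - 2 = (α - 1) + (β - 1) by ring,
      Valuation.map_add_eq_of_lt_left _ (by rw [h₁, h₂]; exact pow_lt_pow_right_of_lt_one₀ hvϖ hϖ1 h), h₂]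

/-- `|(β−1)² − (α−1)²| ≤ |ϖ|^{n₃ + min(n₁,n₂)}` (always). [cite: Serre1980Trees, II §1.1] -/
theorem v_sq_sub_sq_le {ϖ α β : K} (hϖ1 : Valued.v ϖ ≤ 1) {n₁ n₂ n₃ : ℕ} (h₁ : Valued.v (β - 1) = Valued.v ϖ ^ n₁) (h₂ : Valued.v (α - 1) = Valued.v ϖ ^ n₂)
    (h₃ : Valued.v (α - β) = Valued.v ϖ ^ n₃) : Valued.v ((β - 1) * (β - 1) - (α - 1) * (α - 1)) ≤ Valued.v ϖ ^ (n₃ + min n₁ n₂) := by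
  rw [v_sq_sub_sq_eq, h₃, pow_add]
  exact mul_le_mul' le_rfl (v_add_sub_two_le hϖ1 h₁ h₂)

/-- **THE TRICHOTOMY, OFF-LOCUS BRANCH**: `n₁ ≠ n₂ ⇒ |(β−1)² − (α−1)²| = |ϖ|^{n₃ + min(n₁,n₂)}` (on the locus `n₁ = n₂` only `≤` holds — deeper iff `(α−1)+(β−1)`
cancels). [cite: Serre1980Trees, II §1.1] [cite: Rogawski1990, §4.9 Prop. 4.9.1 (a) p. 55] -/
theorem v_sq_sub_sq_eq_of_ne {ϖ α β : K} (hϖ : Valued.v ϖ = exp (-1 : ℤ)) {n₁ n₂ n₃ : ℕ} (h₁ : Valued.v (β - 1) = Valued.v ϖ ^ n₁)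
    (h₂ : Valued.v (α - 1) = Valued.v ϖ ^ n₂) (h₃ : Valued.v (α - β) = Valued.v ϖ ^ n₃) (hne : n₁ ≠ n₂) :
    Valued.v ((β - 1) * (β - 1) - (α - 1) * (α - 1)) = Valued.v ϖ ^ (n₃ + min n₁ n₂) := by
  rw [v_sq_sub_sq_eq, h₃, v_add_sub_two_eq_of_ne hϖ h₁ h₂ hne, pow_add]

end Letter

/-! ## §2  The outer `D₂` read on an equal-depth datum is `ℓ₂ + ρ ≤ 2n₂` -/

section Read

variable {K : Type*} [Field K] [Valued K ℤᵐ⁰]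

/-- **THE OUTER `D₂` READ OF THE H HEADS IS NUMERIC ON `n₁ = n₂ ≤ n₃`**: `(([|(α−1)²| ≤ |ϖ|^{ℓ₂}] ∧ [|(β−1)²| ≤ |ϖ|^{ℓ₂}] ∧ [|0| ≤ |ϖ|^{ℓ₂}]) ∧
|(β−1)²−(α−1)²| ≤ |ϖ|^{ℓ₂+ρ}) ∧ ℓ₂ + ρ ≤ 2n₂ ⟺ ℓ₂ + ρ ≤ 2n₂` — the symbolic conjunct follows from the last one (`ℓ₂ + ρ ≤ 2n₂ ≤ n₂ + n₃`, §1 `v_sq_sub_sq_le`).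
[cite: Kottwitz1986BaseChangeUnits, §1 pp. 240–241] [cite: Serre1980Trees, II §1.1] -/
theorem sqToken_outerRead_H_iff {ϖ α β : K} (hϖ : Valued.v ϖ = exp (-1 : ℤ)) {n₁ n₂ n₃ : ℕ} (h₁ : Valued.v (β - 1) = Valued.v ϖ ^ n₁)
    (h₂ : Valued.v (α - 1) = Valued.v ϖ ^ n₂) (h₃ : Valued.v (α - β) = Valued.v ϖ ^ n₃) (h12 : n₁ = n₂) (h23 : n₂ ≤ n₃) (ℓ₂ ρ : ℕ) :
    (((Valued.v ((α - 1) * (α - 1)) ≤ Valued.v ϖ ^ ℓ₂ ∧ Valued.v ((β - 1) * (β - 1)) ≤ Valued.v ϖ ^ ℓ₂ ∧ Valued.v (0 : K) ≤ Valued.v ϖ ^ ℓ₂) ∧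
          Valued.v ((β - 1) * (β - 1) - (α - 1) * (α - 1)) ≤ Valued.v ϖ ^ (ℓ₂ + ρ)) ∧ ℓ₂ + ρ ≤ 2 * n₂) ↔ ℓ₂ + ρ ≤ 2 * n₂ := by
  obtain ⟨hϖ0, hϖ1⟩ := ne_zero_and_v_lt_one_of_v_eq_exp hϖ
  have hple : ∀ m n : ℕ, Valued.v ϖ ^ m ≤ Valued.v ϖ ^ n ↔ n ≤ m := fun m n => UnitaryLatticeTree.v_pow_le_v_pow_iff hϖ m n
  refine ⟨fun h => h.2, fun h => ⟨⟨⟨?_, ?_, by rw [map_zero]; exact zero_le⟩, ?_⟩, h⟩⟩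
  · rw [map_mul, h₂, ← pow_add, hple]; omega
  · rw [map_mul, h₁, ← pow_add, hple]; omega
  · exact (v_sq_sub_sq_le hϖ1.le h₁ h₂ h₃).trans ((hple _ _).2 (by rw [h12, min_self]; omega))

end Read

/-! ## §3  The H heads with the numeric `D₂` read -/

section Heads

variable {K : Type} [Field K] [Valued K ℤᵐ⁰] [CompleteSpace K] [Fintype 𝓀[K]] {σ : K →+* K} {ϖ : K} {d t : ℕ} {α β : K} {N₀ n₁ n₂ n₃ : ℕ}
  {T : GL (Fin 3) K}

open Classical in
/-- **TWO-TOKEN κ-H CELL, EQUILATERAL FOOT, NUMERIC** (★ p859999 `…_H_sep_levels_foot` with `[reads₂] := [ℓ₂ + ρ ≤ 2m]`; `E₁ = ℓ₁ + 2ρ − m`):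
`Σᶠ_{H, D₁M ⊆ ϖ^{ℓ₁}M ∧ D₂M ⊆ ϖ^{ℓ₂}M} κᵢ·w = [ℓ₂ + 2ρ ≤ 2m] · [ℓ₁ + ρ ≤ m ∧ E₁ ≤ m − d + 1 ∧ 2d − 1 ≤ E₁] · χᴴᵢ(f₀) · q^{2ρ−⌈E₁∕2⌉}` (`ℓ₂ + ρ ≤ 2m` is implied by
`ℓ₂ + 2ρ ≤ 2m`). [cite: Kottwitz1986BaseChangeUnits, §1 pp. 240–241] [cite: Rogawski1990, §4.9 Prop. 4.9.1 (a)(b) p. 55] -/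
theorem finsum_kappaCount_mul_stabiliserWeight_stratum_H_sep_levels_foot_numeric (hD : IsRamifiedQuadraticDatum σ ϖ d t) (h2 : Valued.v (2 : K) < 1)
    (hE : IsElementDatum σ ϖ N₀ α β n₁ n₂ n₃) (hN₀ : d ≤ N₀) (hT : (T : Matrix (Fin 3) (Fin 3) K) = Matrix.diagonal ![α, β, 1])
    (ρ : ℕ) (hρ : 1 ≤ ρ) (h12 : n₁ = n₂) (h13 : n₁ = n₃) (hρm : ρ ≤ n₁) (hm : n₁ < 2 * ρ) (i : Fin 3) (ℓ₁ ℓ₂ : ℕ) (f₀ : K) (hσf₀ : σ f₀ = f₀)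
    (hf₀ : ℓ₁ + 2 * ρ - n₁ ≤ n₁ - d + 1 → Valued.v (f₀ + (β - 1) / (α - 1)) ≤ Valued.v ϖ ^ (ℓ₁ + 2 * ρ - n₁)) :
    ∑ᶠ M ∈ {M | M ∈ stratum σ ϖ T ![2 * ρ, 2 * ρ, 2 * ρ] ∧
        (LatticeInLevel ϖ ℓ₁ (Matrix.diagonal ![α - 1, β - 1, 0]) M ∧ LatticeInLevel ϖ ℓ₂ (Matrix.diagonal ![(α - 1) * (α - 1), (β - 1) * (β - 1), 0]) M)},
        (kappaCount σ ϖ 0 i M : ℚ) * stabiliserWeight σ M =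
      if ℓ₂ + 2 * ρ ≤ 2 * n₁ then
        (if ℓ₁ + ρ ≤ n₁ ∧ ℓ₁ + 2 * ρ - n₁ ≤ n₁ - d + 1 ∧ 2 * d - 1 ≤ ℓ₁ + 2 * ρ - n₁ then
            (((![normSign σ (-(1 + f₀)), normSign σ f₀ * normSign σ (-(1 + f₀)), normSign σ f₀] : Fin 3 → ℤ) i : ℤ) : ℚ) *
              (Fintype.card 𝓀[K] : ℚ) ^ (2 * ρ - (ℓ₁ + 2 * ρ - n₁ + 1) / 2)
          else 0)
      else 0 := by
  classical
  obtain ⟨-, -, -, -, -, h₁, h₂, h₃, -, -, -⟩ := id hE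
  have h₂' : Valued.v (α - 1) = Valued.v ϖ ^ n₁ := by rw [h12]; exact h₂
  rw [finsum_kappaCount_mul_stabiliserWeight_stratum_H_sep_levels_foot hD h2 hE hN₀ hT ρ hρ h12 h13 hρm hm i ℓ₁ ℓ₂ f₀ hσf₀ hf₀,
    if_congr (sqToken_outerRead_H_iff hD.2.2.1 h₁ h₂' h₃ rfl (by omega) ℓ₂ ρ) rfl rfl]
  by_cases hvac : ℓ₂ + 2 * ρ ≤ 2 * n₁
  · rw [if_pos hvac, if_pos hvac, if_pos (by omega)]
  · rw [if_neg hvac, if_neg hvac]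

open Classical in
/-- **TWO-TOKEN κ-H CELL, TUBE, NUMERIC** (★ p859999 `…_H_sep_levels_tube` with `[reads₂] := [ℓ₂ + ρ ≤ 2n₂]`, automatically true under `ℓ₂ ≤ 2ρ ≤ n₂`; `E₁ = ℓ₁ + 2ρ − n₂`):
`= 0 if ℓ₁ + 2ρ ≤ n₂ ; [ℓ₁ + ρ ≤ n₂ ∧ n₃ = n₂ ∧ E₁ ≤ n₃ − d + 1 ∧ 2d − 1 ≤ E₁] · χᴴᵢ(f₀) · q^{2ρ−⌈E₁∕2⌉} otherwise`.
[cite: Kottwitz1986BaseChangeUnits, §1 pp. 240–241] [cite: Rogawski1990, §4.9 Prop. 4.9.1 (a)(b) p. 55] -/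
theorem finsum_kappaCount_mul_stabiliserWeight_stratum_H_sep_levels_tube_numeric (hD : IsRamifiedQuadraticDatum σ ϖ d t) (h2 : Valued.v (2 : K) < 1)
    (hE : IsElementDatum σ ϖ N₀ α β n₁ n₂ n₃) (hN₀ : d ≤ N₀) (hT : (T : Matrix (Fin 3) (Fin 3) K) = Matrix.diagonal ![α, β, 1])
    (ρ : ℕ) (hρ : 1 ≤ ρ) (h12 : n₁ = n₂) (htube : 2 * ρ ≤ n₂) (hn₃ : ρ ≤ n₃) (i : Fin 3) (ℓ₁ ℓ₂ : ℕ) (hℓ₂ : ℓ₂ ≤ 2 * ρ) (f₀ : K) (hσf₀ : σ f₀ = f₀)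
    (hf₀ : ℓ₁ + 2 * ρ - n₂ ≤ n₃ - d + 1 → Valued.v (f₀ + (β - 1) / (α - 1)) ≤ Valued.v ϖ ^ (ℓ₁ + 2 * ρ - n₂)) :
    ∑ᶠ M ∈ {M | M ∈ stratum σ ϖ T ![2 * ρ, 2 * ρ, 2 * ρ] ∧
        (LatticeInLevel ϖ ℓ₁ (Matrix.diagonal ![α - 1, β - 1, 0]) M ∧ LatticeInLevel ϖ ℓ₂ (Matrix.diagonal ![(α - 1) * (α - 1), (β - 1) * (β - 1), 0]) M)},
        (kappaCount σ ϖ 0 i M : ℚ) * stabiliserWeight σ M =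
      if ℓ₁ + 2 * ρ ≤ n₂ then 0
      else
        (if ℓ₁ + ρ ≤ n₂ ∧ n₃ = n₂ ∧ ℓ₁ + 2 * ρ - n₂ ≤ n₃ - d + 1 ∧ 2 * d - 1 ≤ ℓ₁ + 2 * ρ - n₂ then
            (((![normSign σ (-(1 + f₀)), normSign σ f₀ * normSign σ (-(1 + f₀)), normSign σ f₀] : Fin 3 → ℤ) i : ℤ) : ℚ) *
              (Fintype.card 𝓀[K] : ℚ) ^ (2 * ρ - (ℓ₁ + 2 * ρ - n₂ + 1) / 2)
          else 0) := by
  classical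
  obtain ⟨-, -, -, -, -, h₁, h₂, h₃, -, -, -⟩ := id hE
  have h23 : n₂ ≤ n₃ := by
    rcases isoceles_of_isElementDatum hD hE with ⟨-, h⟩ | ⟨h, h'⟩ | ⟨h, h'⟩ <;> omega
  rw [finsum_kappaCount_mul_stabiliserWeight_stratum_H_sep_levels_tube hD h2 hE hN₀ hT ρ hρ h12 htube hn₃ i ℓ₁ ℓ₂ hℓ₂ f₀ hσf₀ hf₀,
    if_congr (sqToken_outerRead_H_iff hD.2.2.1 h₁ h₂ h₃ h12 h23 ℓ₂ ρ) rfl rfl, if_pos (by omega)]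

open Classical in
/-- **ONE-TOKEN κ-H CELL AT `D₂`, EQUILATERAL FOOT, NUMERIC** (★ p859864 `…_H_sep_sqToken_foot` with `[reads] := [ℓ + ρ ≤ 2m]`):
`Σᶠ_{H, D₂M ⊆ ϖ^ℓM} κᵢ·w = [ℓ + 2ρ ≤ 2m] · (★ κH value)`. [cite: Kottwitz1986BaseChangeUnits, §1 pp. 240–241] [cite: Rogawski1990, §4.9 Prop. 4.9.1 (a)(b) p. 55] -/
theorem finsum_kappaCount_mul_stabiliserWeight_stratum_H_sep_sqToken_foot_numeric (hD : IsRamifiedQuadraticDatum σ ϖ d t) (h2 : Valued.v (2 : K) < 1)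
    (hE : IsElementDatum σ ϖ N₀ α β n₁ n₂ n₃) (hN₀ : d ≤ N₀) (hT : (T : Matrix (Fin 3) (Fin 3) K) = Matrix.diagonal ![α, β, 1])
    (ρ : ℕ) (hρ : 1 ≤ ρ) (h12 : n₁ = n₂) (h13 : n₁ = n₃) (hρm : ρ ≤ n₁) (hm : n₁ < 2 * ρ) (i : Fin 3) (f₀ : K) (hσf₀ : σ f₀ = f₀)
    (hf₀ : n₁ = n₂ → n₂ = n₃ → n₁ < 2 * ρ → 2 * ρ - n₁ ≤ n₁ - d + 1 → Valued.v (f₀ + (β - 1) / (α - 1)) ≤ Valued.v ϖ ^ (2 * ρ - n₁)) (ℓ : ℕ) :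
    ∑ᶠ M ∈ {M | M ∈ stratum σ ϖ T ![2 * ρ, 2 * ρ, 2 * ρ] ∧
        LatticeInLevel ϖ ℓ (Matrix.diagonal ![(α - 1) * (α - 1), (β - 1) * (β - 1), 0]) M}, (kappaCount σ ϖ 0 i M : ℚ) * stabiliserWeight σ M =
      if ℓ + 2 * ρ ≤ 2 * n₁ then
        (if n₁ = n₂ ∧ n₂ = n₃ ∧ n₁ < 2 * ρ ∧ 2 * ρ - n₁ ≤ n₁ - d + 1 ∧ d ≤ (2 * ρ - n₁ + 1) / 2
          then (((![normSign σ (-(1 + f₀)), normSign σ f₀ * normSign σ (-(1 + f₀)), normSign σ f₀] : Fin 3 → ℤ) i : ℤ) : ℚ) *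
            (Fintype.card 𝓀[K] : ℚ) ^ (2 * ρ - (2 * ρ - n₁ + 1) / 2)
          else 0)
      else 0 := by
  classical
  obtain ⟨-, -, -, -, -, h₁, h₂, h₃, -, -, -⟩ := id hE
  have h₂' : Valued.v (α - 1) = Valued.v ϖ ^ n₁ := by rw [h12]; exact h₂
  rw [finsum_kappaCount_mul_stabiliserWeight_stratum_H_sep_sqToken_foot hD h2 hE hN₀ hT ρ hρ h12 h13 hρm hm i f₀ hσf₀ hf₀ ℓ,
    if_congr (sqToken_outerRead_H_iff hD.2.2.1 h₁ h₂' h₃ rfl (by omega) ℓ ρ) rfl rfl]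
  by_cases hvac : ℓ + 2 * ρ ≤ 2 * n₁
  · rw [if_pos (show ℓ + ρ ≤ 2 * n₁ by omega), if_pos hvac]
  · rw [if_neg hvac]
    exact ite_self _

open Classical in
/-- **ONE-TOKEN κ-H CELL AT `D₂`, TUBE WITH `n₁ = n₂`, NUMERIC** (★ p859864 `…_H_sep_sqToken_tube` with `[reads] := [ℓ + ρ ≤ 2n₂]`, true under `ℓ ≤ 2ρ ≤ n₂`): the
label-cut sum IS ★ κH's value (`0` in the tube). [cite: Kottwitz1986BaseChangeUnits, §1 pp. 240–241] [cite: Rogawski1990, §4.9 Prop. 4.9.1 (a)(b) p. 55] -/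
theorem finsum_kappaCount_mul_stabiliserWeight_stratum_H_sep_sqToken_tube_numeric (hD : IsRamifiedQuadraticDatum σ ϖ d t) (h2 : Valued.v (2 : K) < 1)
    (hE : IsElementDatum σ ϖ N₀ α β n₁ n₂ n₃) (hN₀ : d ≤ N₀) (hT : (T : Matrix (Fin 3) (Fin 3) K) = Matrix.diagonal ![α, β, 1])
    (ρ : ℕ) (hρ : 1 ≤ ρ) (h12 : n₁ = n₂) (htube : 2 * ρ ≤ n₂) (hn₃ : ρ ≤ n₃) (i : Fin 3) (f₀ : K) (hσf₀ : σ f₀ = f₀)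
    (hf₀ : n₁ = n₂ → n₂ = n₃ → n₁ < 2 * ρ → 2 * ρ - n₁ ≤ n₁ - d + 1 → Valued.v (f₀ + (β - 1) / (α - 1)) ≤ Valued.v ϖ ^ (2 * ρ - n₁)) (ℓ : ℕ)
    (hℓ : ℓ ≤ 2 * ρ) :
    ∑ᶠ M ∈ {M | M ∈ stratum σ ϖ T ![2 * ρ, 2 * ρ, 2 * ρ] ∧
        LatticeInLevel ϖ ℓ (Matrix.diagonal ![(α - 1) * (α - 1), (β - 1) * (β - 1), 0]) M}, (kappaCount σ ϖ 0 i M : ℚ) * stabiliserWeight σ M =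
      if n₁ = n₂ ∧ n₂ = n₃ ∧ n₁ < 2 * ρ ∧ 2 * ρ - n₁ ≤ n₁ - d + 1 ∧ d ≤ (2 * ρ - n₁ + 1) / 2
        then (((![normSign σ (-(1 + f₀)), normSign σ f₀ * normSign σ (-(1 + f₀)), normSign σ f₀] : Fin 3 → ℤ) i : ℤ) : ℚ) *
          (Fintype.card 𝓀[K] : ℚ) ^ (2 * ρ - (2 * ρ - n₁ + 1) / 2)
        else 0 := by
  classical
  obtain ⟨-, -, -, -, -, h₁, h₂, h₃, -, -, -⟩ := id hE
  have h23 : n₂ ≤ n₃ := by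
    rcases isoceles_of_isElementDatum hD hE with ⟨-, h⟩ | ⟨h, h'⟩ | ⟨h, h'⟩ <;> omega
  rw [finsum_kappaCount_mul_stabiliserWeight_stratum_H_sep_sqToken_tube hD h2 hE hN₀ hT ρ hρ h12 htube hn₃ i f₀ hσf₀ hf₀ ℓ hℓ,
    if_congr (sqToken_outerRead_H_iff hD.2.2.1 h₁ h₂ h₃ h12 h23 ℓ ρ) rfl rfl, if_pos (by omega)]

end Heads

end Summit.HodgeConjecture.HodgeConjecture.Cruxes.H413.F0P3cDyRamSqTokenReadLetter

end
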